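import Literature.Analysis.OperatorTheory.KernelRatioLimit
import HarnessLib

/-!
# Pointwise geometric asymptotics of the iterates of a positive symmetric transfer kernel

Helper file (`--supports stmt-AtomisticToContinuum-12240`, item `HalfChainLocality` of route
`BoundaryEscapeDeficit`, sub-problem `FouriersLaw`). The convergence of the boundary Gibbs marginals of
the pinned chain as the length `M → ∞` is a one-dimensional transfer-operator statement; this file
packages the abstract analytic input, assembled from the tree's operator theory
(`Literature.Analysis.OperatorTheory.exists_transferOperator`: the `L²` transfer operator `A` of a
bounded, symmetric, strictly positive kernel `K` on a finite nonzero measure space `(X, μ)`;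
`IsPositivityImproving.exists_norm_pow_sub_le`: Jentzsch's gap `‖Aⁿ g - ‖A‖ⁿ ⟪φ, g⟫ φ‖ ≤ θⁿ ‖g‖`;
`KernelIterateBridge`: `⟪k_u, A^j [h]⟫ = (κ^[j+1] h)(u)` for the POINTWISE operator
`(κ f)(x) = ∫ K(x, y) f(y) dμ(y)`), in the honest-function form consumed downstream:

* `exists_kernelIterate_asymptotics` — there are `λ > θ ≥ 0` and an `L²`-normalised, a.e. strictly
  positive `φ₀` with `κ φ₀ = λ φ₀` a.e. such that, for bounded measurable `h`, `g`,
  `|(κ^[n+1] h)(x) - λⁿ (κ φ₀)(x) ∫ φ₀ h dμ| ≤ C B μ(X) θⁿ` for EVERY `x` (uniform pointwise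
  asymptotics) and `|∫ g (κ^[n] h) dμ - λⁿ (∫ φ₀ g)(∫ φ₀ h)| ≤ B_g B_h μ(X) θⁿ`.

No definitions; everything is folklore (Perron–Frobenius–Jentzsch / Kreĭn–Rutman for compact
positivity improving self-adjoint operators, Reed–Simon IV Thms XIII.43–44).
-/

noncomputable section

open MeasureTheory Set Filter Function
open scoped RealInnerProductSpace ENNReal

namespace Summit.AtomisticToContinuum.FouriersLaw.Theorems.HalfChainLocality

open Literature.Analysis.OperatorTheory

variable {X : Type*} [MeasurableSpace X] {μ : Measure X} [IsFiniteMeasure μ]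
  {K : X → X → ℝ} {C : ℝ}

/-- `(μ(X))^{1/2} · (μ(X))^{1/2} = μ(X)` for the `L²`-exponent `(2 : ℝ≥0∞).toReal⁻¹`. [folklore] -/
theorem measureUnivNNReal_rpow_half_mul_self (μ : Measure X) [IsFiniteMeasure μ] :
    (measureUnivNNReal μ : ℝ) ^ (2 : ℝ≥0∞).toReal⁻¹ * (measureUnivNNReal μ : ℝ) ^ (2 : ℝ≥0∞).toReal⁻¹ =
      μ.real univ := by
  have h0 : 0 ≤ (measureUnivNNReal μ : ℝ) := NNReal.coe_nonneg _
  rw [← Real.rpow_add' h0 (by norm_num), ENNReal.toReal_ofNat]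
  norm_num
  rfl

/-- The `L²` norm of the class of a function bounded by `B` is at most `B (μ X)^{1/2}`. [folklore] -/
theorem norm_toLp_le_of_bound {h : X → ℝ} (hh : Measurable h) {B : ℝ} (hhb : ∀ x, ‖h x‖ ≤ B) :
    ‖(memLp_two_of_bound (μ := μ) hh hhb).toLp h‖ ≤
      (measureUnivNNReal μ : ℝ) ^ (2 : ℝ≥0∞).toReal⁻¹ * B := by
  by_cases hX : Nonempty X
  · obtain ⟨x⟩ := hX
    have hB : 0 ≤ B := (norm_nonneg _).trans (hhb x)
    exact Lp.norm_le_of_ae_bound hB (by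
      filter_upwards [(memLp_two_of_bound (μ := μ) hh hhb).coeFn_toLp] with y hy
      rw [hy]
      exact hhb y)
  · haveI : IsEmpty X := not_nonempty_iff.1 hX
    have hμ0 : μ = 0 := Measure.eq_zero_of_isEmpty μ
    have h0 : (memLp_two_of_bound (μ := μ) hh hhb).toLp h = 0 :=
      Lp.eq_zero_iff_ae_eq_zero.2 (Filter.Eventually.of_forall fun x => (IsEmpty.false x).elim)
    rw [h0, norm_zero]
    have : (measureUnivNNReal μ : ℝ) = 0 := by rw [hμ0, measureUnivNNReal_zero, NNReal.coe_zero]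
    rw [this, Real.zero_rpow (by norm_num), zero_mul]

/-- `⟪φ, [h]⟫ = ∫ φ h dμ` for the class `[h]` of a bounded measurable `h`. [folklore] -/
theorem inner_toLp_eq_integral (φ : Lp ℝ 2 μ) {h : X → ℝ} (hh : Measurable h) {B : ℝ}
    (hhb : ∀ x, ‖h x‖ ≤ B) :
    ⟪φ, (memLp_two_of_bound (μ := μ) hh hhb).toLp h⟫ = ∫ y, φ y * h y ∂μ := by
  rw [inner_eq_integral]
  refine integral_congr_ae ?_
  filter_upwards [(memLp_two_of_bound (μ := μ) hh hhb).coeFn_toLp] with y hy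
  rw [hy]

/-- **Pointwise geometric asymptotics of transfer-kernel iterates (Jentzsch's gap, honest-function
form).** For a bounded (`‖K‖ ≤ C`), symmetric, strictly positive, jointly measurable kernel `K` on a
finite nonzero measure space `(X, μ)`, with `(κ f)(x) = ∫ K(x,y) f(y) dμ(y)`: there are `λ > 0`,
`θ ∈ [0, λ)` and `φ₀ ∈ L²(μ)`, `φ₀ > 0` a.e., `∫ φ₀² = 1`, `κ φ₀ = λ φ₀` a.e. (`φ₀` strongly
measurable, `∫ φ₀ > 0`, `κ φ₀ > 0` everywhere and `|κ φ₀| ≤ C √μ(X)`), such that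
(i) for every measurable `h` with `‖h‖ ≤ B`, every `n` and EVERY point `x`,
`|(κ^[n+1] h)(x) - λⁿ (κ φ₀)(x) ∫ φ₀ h dμ| ≤ C B μ(X) θⁿ`;
(ii) for measurable `g, h` with `‖g‖ ≤ B_g`, `‖h‖ ≤ B_h` and every `n`,
`|∫ g (κ^[n] h) dμ - λⁿ (∫ φ₀ g dμ)(∫ φ₀ h dμ)| ≤ B_g B_h μ(X) θⁿ`. [folklore] -/
theorem exists_kernelIterate_asymptotics (hK : StronglyMeasurable (uncurry K))
    (hC : ∀ x y, ‖K x y‖ ≤ C) (hsymm : ∀ x y, K x y = K y x) (hpos : ∀ x y, 0 < K x y)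
    (hμ : μ ≠ 0) :
    ∃ (lam θ : ℝ) (φ₀ : X → ℝ), 0 < lam ∧ 0 ≤ θ ∧ θ < lam ∧
      MemLp φ₀ 2 μ ∧ (∀ᵐ x ∂μ, 0 < φ₀ x) ∧ (∫ x, φ₀ x ^ 2 ∂μ = 1) ∧
      ((fun x => ∫ y, K x y * φ₀ y ∂μ) =ᵐ[μ] fun x => lam * φ₀ x) ∧
      StronglyMeasurable φ₀ ∧ (0 < ∫ y, φ₀ y ∂μ) ∧
      (∀ x, 0 < ∫ y, K x y * φ₀ y ∂μ) ∧ (∀ x, |∫ y, K x y * φ₀ y ∂μ| ≤ C * Real.sqrt (μ.real univ)) ∧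
      (∀ (h : X → ℝ), Measurable h → ∀ B : ℝ, (∀ x, ‖h x‖ ≤ B) → ∀ (n : ℕ) (x : X),
        |((fun f : X → ℝ => fun x => ∫ y, K x y * f y ∂μ)^[n + 1] h) x -
            lam ^ n * (∫ y, K x y * φ₀ y ∂μ) * ∫ y, φ₀ y * h y ∂μ| ≤
          C * B * μ.real univ * θ ^ n) ∧
      (∀ (g h : X → ℝ), Measurable g → Measurable h → ∀ Bg Bh : ℝ, (∀ x, ‖g x‖ ≤ Bg) →
        (∀ x, ‖h x‖ ≤ Bh) → ∀ n : ℕ,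
        |∫ x, g x * ((fun f : X → ℝ => fun x => ∫ y, K x y * f y ∂μ)^[n] h) x ∂μ -
            lam ^ n * (∫ y, φ₀ y * g y ∂μ) * ∫ y, φ₀ y * h y ∂μ| ≤
          Bg * Bh * μ.real univ * θ ^ n) := by
  obtain ⟨A, hA, hsa, hc, himp, h0⟩ := exists_transferOperator (μ := μ) hK hC hsymm hpos hμ
  obtain ⟨φ, hφ1, hφpos, hAφ, θ, hθ0, hθ, hpow⟩ := himp.exists_norm_pow_sub_le hsa hc h0
  have hlam : 0 < ‖A‖ := norm_pos_iff.2 h0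
  have hC0 : 0 ≤ C := by
    have : μ univ ≠ 0 := fun h => hμ (Measure.measure_univ_eq_zero.1 h)
    obtain ⟨x, -⟩ := nonempty_of_measure_ne_zero this
    exact (norm_nonneg _).trans (hC x x)
  set s : ℝ := (measureUnivNNReal μ : ℝ) ^ (2 : ℝ≥0∞).toReal⁻¹ with hs
  have hs0 : 0 ≤ s := Real.rpow_nonneg (NNReal.coe_nonneg _) _
  have hss : s * s = μ.real univ := measureUnivNNReal_rpow_half_mul_self μ
  -- kernel sections
  set ks : X → Lp ℝ 2 μ := fun u => (memLp_kernel_section (μ := μ) hK hC u).toLp (K u) with hks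
  have hksb : ∀ u, ‖ks u‖ ≤ s * C := fun u => norm_kernel_section_le hK hC hC0 u
  -- `⟪k_x, φ⟫ = (κ φ)(x)`
  have hkφ : ∀ x, ⟪ks x, φ⟫ = ∫ y, K x y * φ y ∂μ := by
    intro x
    rw [real_inner_comm, hks, inner_kernel_section hK hC φ x]
    exact integral_congr_ae (Eventually.of_forall fun y => mul_comm _ _)
  refine ⟨‖A‖, θ, (φ : X → ℝ), hlam, hθ0, hθ, Lp.memLp φ, hφpos, ?_, ?_, ?_, ?_, ?_, ?_, ?_, ?_⟩
  · -- `∫ φ² = ‖φ‖² = 1`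
    have h1 : ⟪φ, φ⟫ = ∫ x, (φ : X → ℝ) x ^ 2 ∂μ := by
      rw [inner_eq_integral]
      exact integral_congr_ae (Eventually.of_forall fun x => by simp [sq])
    rw [← h1, real_inner_self_eq_norm_sq, hφ1, one_pow]
  · -- the eigen-equation, pointwise a.e.
    filter_upwards [hA φ, Lp.coeFn_smul ‖A‖ φ] with x hx hsm
    rw [← hx, hAφ, hsm, Pi.smul_apply, smul_eq_mul]
  · exact Lp.stronglyMeasurable φ
  · -- `∫ φ₀ > 0`
    have hint : Integrable (φ : X → ℝ) μ := (Lp.memLp φ).integrable one_le_two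
    rw [integral_pos_iff_support_of_nonneg_ae (hφpos.mono fun x hx => hx.le) hint]
    have hsupp : μ (Function.support (φ : X → ℝ)) = μ univ := by
      refine measure_congr ?_
      filter_upwards [hφpos] with x hx
      simp only [eq_iff_iff]
      exact ⟨fun _ => Set.mem_univ x, fun _ => Function.mem_support.2 hx.ne'⟩
    rw [hsupp]
    exact pos_iff_ne_zero.2 fun h => hμ (Measure.measure_univ_eq_zero.1 h)
  · -- `κ φ₀ > 0` everywhere
    intro x
    have hint : Integrable (fun y => K x y * (φ : X → ℝ) y) μ := integrable_kernel_mul_coeFn hK hC φ x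
    have hnn : 0 ≤ᵐ[μ] fun y => K x y * (φ : X → ℝ) y :=
      hφpos.mono fun y hy => mul_nonneg (hpos x y).le hy.le
    rw [integral_pos_iff_support_of_nonneg_ae hnn hint]
    have hsupp : μ (Function.support fun y => K x y * (φ : X → ℝ) y) = μ univ := by
      refine measure_congr ?_
      filter_upwards [hφpos] with y hy
      simp only [eq_iff_iff]
      exact ⟨fun _ => Set.mem_univ y, fun _ => Function.mem_support.2 (mul_pos (hpos x y) hy).ne'⟩
    rw [hsupp]
    exact pos_iff_ne_zero.2 fun h => hμ (Measure.measure_univ_eq_zero.1 h)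
  · -- `|κ φ₀| ≤ C √μ(X)`
    intro x
    have h := abs_integral_kernel_mul_le (μ := μ) hC hC0 φ x
    rwa [hφ1, mul_one] at h
  · -- (i) pointwise asymptotics
    intro h hh B hhb n x
    have hL := memLp_two_of_bound (μ := μ) hh hhb
    have hB : ‖hL.toLp h‖ ≤ s * B := norm_toLp_le_of_bound hh hhb
    have hB0 : 0 ≤ B := (norm_nonneg _).trans (hhb x)
    set r : Lp ℝ 2 μ := (A ^ n) (hL.toLp h) - (‖A‖ ^ n * ⟪φ, hL.toLp h⟫) • φ with hr
    have hrb : ‖r‖ ≤ θ ^ n * ‖hL.toLp h‖ := hpow n _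
    have hiter := inner_kernel_section_pow_kernelOp (μ := μ) hK hC hsymm hA hh hhb n x
    -- `κ^[n+1] h x = ⟪k_x, A^n [h]⟫ = ‖A‖^n ⟪φ,[h]⟫ ⟪k_x, φ⟫ + ⟪k_x, r⟫`
    have hdec : ((fun f : X → ℝ => fun x => ∫ y, K x y * f y ∂μ)^[n + 1] h) x =
        ‖A‖ ^ n * (∫ y, K x y * φ y ∂μ) * (∫ y, φ y * h y ∂μ) + ⟪ks x, r⟫ := by
      change ⟪ks x, (A ^ n) (hL.toLp h)⟫ = _ at hiter
      rw [← hiter]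
      have e : (A ^ n) (hL.toLp h) = (‖A‖ ^ n * ⟪φ, hL.toLp h⟫) • φ + r := by
        rw [hr]; abel
      rw [e, inner_add_right, real_inner_smul_right, hkφ x, inner_toLp_eq_integral φ hh hhb]
      ring
    rw [hdec, add_sub_cancel_left]
    calc |⟪ks x, r⟫| ≤ ‖ks x‖ * ‖r‖ := abs_real_inner_le_norm _ _
      _ ≤ (s * C) * (θ ^ n * (s * B)) := by
          refine mul_le_mul (hksb x) (hrb.trans ?_) (norm_nonneg _) (by positivity)
          exact mul_le_mul_of_nonneg_left hB (pow_nonneg hθ0 n)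
      _ = C * B * (s * s) * θ ^ n := by ring
      _ = C * B * μ.real univ * θ ^ n := by rw [hss]
  · -- (ii) bilinear asymptotics
    intro g h hg hh Bg Bh hgb hhb n
    have hLg := memLp_two_of_bound (μ := μ) hg hgb
    have hLh := memLp_two_of_bound (μ := μ) hh hhb
    have hBg : ‖hLg.toLp g‖ ≤ s * Bg := norm_toLp_le_of_bound hg hgb
    have hBh : ‖hLh.toLp h‖ ≤ s * Bh := norm_toLp_le_of_bound hh hhb
    set r : Lp ℝ 2 μ := (A ^ n) (hLh.toLp h) - (‖A‖ ^ n * ⟪φ, hLh.toLp h⟫) • φ with hr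
    have hrb : ‖r‖ ≤ θ ^ n * ‖hLh.toLp h‖ := hpow n _
    -- `∫ g κ^[n] h = ⟪[g], A^n [h]⟫`
    have hint : ∫ x, g x * ((fun f : X → ℝ => fun x => ∫ y, K x y * f y ∂μ)^[n] h) x ∂μ =
        ⟪hLg.toLp g, (A ^ n) (hLh.toLp h)⟫ := by
      rw [inner_eq_integral]
      refine integral_congr_ae ?_
      filter_upwards [hLg.coeFn_toLp, pow_kernelOp_toLp_ae_eq_iterate hA hh hhb n] with x hx hy
      rw [hx, hy]
    have hdec : ∫ x, g x * ((fun f : X → ℝ => fun x => ∫ y, K x y * f y ∂μ)^[n] h) x ∂μ =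
        ‖A‖ ^ n * (∫ y, φ y * g y ∂μ) * (∫ y, φ y * h y ∂μ) + ⟪hLg.toLp g, r⟫ := by
      rw [hint]
      have e : (A ^ n) (hLh.toLp h) = (‖A‖ ^ n * ⟪φ, hLh.toLp h⟫) • φ + r := by
        rw [hr]; abel
      rw [e, inner_add_right, real_inner_smul_right, real_inner_comm φ (hLg.toLp g),
        inner_toLp_eq_integral φ hg hgb, inner_toLp_eq_integral φ hh hhb]
      ring
    rw [hdec, add_sub_cancel_left]
    by_cases hX : Nonempty X
    · obtain ⟨x₀⟩ := hX
      have hBg0 : 0 ≤ Bg := (norm_nonneg _).trans (hgb x₀)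
      calc |⟪hLg.toLp g, r⟫| ≤ ‖hLg.toLp g‖ * ‖r‖ := abs_real_inner_le_norm _ _
        _ ≤ (s * Bg) * (θ ^ n * (s * Bh)) := by
            refine mul_le_mul hBg (hrb.trans ?_) (norm_nonneg _) (by positivity)
            exact mul_le_mul_of_nonneg_left hBh (pow_nonneg hθ0 n)
        _ = Bg * Bh * (s * s) * θ ^ n := by ring
        _ = Bg * Bh * μ.real univ * θ ^ n := by rw [hss]
    · haveI : IsEmpty X := not_nonempty_iff.1 hX
      exact absurd (Measure.eq_zero_of_isEmpty μ) hμ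

end Summit.AtomisticToContinuum.FouriersLaw.Theorems.HalfChainLocality

end
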